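import Summits.AtomisticToContinuum.HydrodynamicLimit.Theorems.AntiMazurCoboundariesCorrectorPressureDecayTangentBiasHolds

/-!
# Window sums are integrable along tangent states (line `FirstLemma`, crux stmt-AtomisticToContinuum-14135)

A SANITY LEMMA for the wall `EntropicBoltzmannPropertyTangent` (…KiferWall.lean): its left-hand side is the Bochner integral
`∫ windowSumReal ω [0,1)³ (g((√θ)⁻¹(p.2 − u₀))) ∂μ`, which would take the JUNK VALUE `0` for a non-integrable window functional
and make the wall vacuous there. Within the wall's own hypotheses this never happens: for every tangent state `μ` of a tangent
family (any weight `0 ≤ φ ≤ 1` with `∫φ > 0`) and every bounded continuous `G` on `ℝ³ × ℝ³`, the unit-cube window functional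
`ω ↦ windowSumReal ω [0,1)³ G` is `μ`-integrable (`stub_integrableWindowSum`, registered). Proof, from landed pieces only: the
one-body limit (`stub_oneBodyLimit`, p142719) feeds the Campbell bound (`stub_campbellBound`, p142492) with `R = −1, δ = 1`,
giving the INTENSITY BOUND `E_μ[#([0,1)³ × ℝ³)] ≤ (∫φ)⁻¹ σ³ < ∞`, and the window bookkeeping (`windowSum_approx`, p141562)
turns a finite mean count into integrability of every bounded continuous window sum.
-/

noncomputable section

open MeasureTheory ProbabilityTheory Set Filter Topology
open scoped ENNReal

namespace Summit.AtomisticToContinuum.HydrodynamicLimit.Theorems.KiferCompactification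

open Literature.MathematicalPhysics.KineticTheory (T3 V3 hsDiameter blowUpPoint)
open Literature.Analysis.FluidPDE (HardSphereFlow Config windowSumReal)
open Literature.Analysis.FunctionSpaces (PointConfig)
open Literature.Analysis.FunctionSpaces.Torus (unitCube measurableSet_unitCube)

/-- **Intensity bound of tangent states** (from the one-body limit and the Campbell bound): along a tangent state `μ` of a
tangent family, `E_μ[#(S × ℝ³)] ≤ (∫φ)⁻¹ σ³ · vol S` for every measurable `S ⊆ ℝ³`. -/
theorem lintegral_count_prod_univ_le_of_isTangentState {σ a θ : ℝ} {u₀ : V3} {κ : ℝ} (hσ : 0 < σ)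
    {φ : T3 → ℝ} (hφ : Continuous φ) (hφ0 : ∀ x, 0 ≤ φ x) (hφ1 : ∀ x, φ x ≤ 1) (hφi : 0 < ∫ x, φ x)
    {N : ℕ → ℕ}
    {Φ : ∀ k, HardSphereFlow (Literature.Analysis.FluidPDE.Torus.geometry (Fin 3)) (hsDiameter σ (N k)) (N k + 1)}
    {Q : ∀ k, Measure (Config (N k + 1) (Fin 3) T3)} (hfam : IsTangentFamily σ a θ u₀ κ N Φ Q)
    {ι : ℕ → ℕ} {μ : Measure (PointConfig (V3 × V3))} (hμ : IsTangentState σ φ N Q ι μ)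
    {S : Set V3} (hS : MeasurableSet S) :
    ∫⁻ ω, ((ω.count (S ×ˢ (univ : Set V3)) : ℕ∞) : ℝ≥0∞) ∂μ ≤ ENNReal.ofReal ((∫ x, φ x)⁻¹ * σ ^ 3) * volume S := by
  have hQprob : ∀ k, IsProbabilityMeasure (Q k) := hfam.2.1
  -- the one-body limit, restricted to nonnegative test functions
  have hone : ∀ (h : V3 × V3 → ℝ), Continuous h → HasCompactSupport h → (∀ p, 0 ≤ h p) →
      Integrable (fun ω : PointConfig (V3 × V3) => ω.sumFn h) μ ∧
      Tendsto (fun k => (∫ x, φ x)⁻¹ * ∫ x : T3, φ x *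
          ∫ z, (∑ i, h (blowUpPoint (hsDiameter σ (N (ι k))) x (z i))) ∂Q (ι k)) atTop
        (𝓝 (∫ ω, ω.sumFn h ∂μ)) := fun h hh hhs _ =>
    stub_oneBodyLimit σ a θ u₀ κ hσ φ hφ hφ0 hφ1 hφi N Φ Q hfam ι μ hμ h hh hhs
  -- every particle has velocity of norm `> -1`: the tail functional is the particle number
  have huniv : {v : V3 | (-1 : ℝ) < ‖v‖} = univ :=
    eq_univ_of_forall fun v => lt_of_lt_of_le neg_one_lt_zero (norm_nonneg v)
  have htail1 : ∀ k, ((N (ι k) + 1 : ℕ) : ℝ)⁻¹ *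
      ∫ z, (∑ i, ({v : V3 | (-1 : ℝ) < ‖v‖}).indicator (fun _ => (1 : ℝ)) (z i).2) ∂Q (ι k) ≤ 1 := by
    intro k
    haveI := hQprob (ι k)
    have hsum : ∀ z : Config (N (ι k) + 1) (Fin 3) T3,
        (∑ i, ({v : V3 | (-1 : ℝ) < ‖v‖}).indicator (fun _ => (1 : ℝ)) (z i).2) = ((N (ι k) + 1 : ℕ) : ℝ) := by
      intro z
      rw [huniv]
      simp
    simp_rw [hsum]
    rw [integral_const, probReal_univ, one_smul, inv_mul_cancel₀ (by positivity)]
  have h := stub_campbellBound σ a θ u₀ κ hσ φ hφ hφ0 hφ1 hφi N Φ Q hfam ι μ hμ hone (-1) 1 zero_le_one htail1 S hS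
  rwa [huniv, mul_one] at h

/-- **Window sums are integrable along tangent states** (registered sanity stub `stub_integrableWindowSum` of line
`FirstLemma`): for every tangent state `μ` of a tangent family and every bounded continuous `G : ℝ³ × ℝ³ → ℝ`, the unit-cube
window functional `ω ↦ windowSumReal ω [0,1)³ G` is `μ`-integrable — so the wall's left-hand side `∫ windowSumReal … ∂μ` is an
honest expectation, never the junk value of a non-integrable integrand. -/
theorem stub_integrableWindowSum : ∀ (σ a θ : ℝ) (u₀ : V3) (κ : ℝ), 0 < σ →
    ∀ (φ : T3 → ℝ), Continuous φ → (∀ x, 0 ≤ φ x) → (∀ x, φ x ≤ 1) → 0 < ∫ x, φ x →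
    ∀ (N : ℕ → ℕ)
      (Φ : ∀ k, HardSphereFlow (Literature.Analysis.FluidPDE.Torus.geometry (Fin 3)) (hsDiameter σ (N k)) (N k + 1))
      (Q : ∀ k, Measure (Config (N k + 1) (Fin 3) T3)),
      IsTangentFamily σ a θ u₀ κ N Φ Q →
      ∀ (ι : ℕ → ℕ) (μ : Measure (PointConfig (V3 × V3))), IsTangentState σ φ N Q ι μ →
      ∀ (G : V3 × V3 → ℝ) (K : ℝ), Continuous G → (∀ p, |G p| ≤ K) →
        Integrable (fun ω : PointConfig (V3 × V3) => windowSumReal ω (unitCube (Fin 3)) G) μ := by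
  intro σ a θ u₀ κ hσ φ hφ hφ0 hφ1 hφi N Φ Q hfam ι μ hμ G K hG hGK
  have hQprob : ∀ k, IsProbabilityMeasure (Q k) := hfam.2.1
  haveI : IsProbabilityMeasure μ := isProbabilityMeasure_of_isTangentState hφi hQprob hμ
  -- finite mean number of particles above the unit cube
  have hcube_fin : ∫⁻ ω, ((ω.count (unitCube (Fin 3) ×ˢ (univ : Set V3)) : ℕ∞) : ℝ≥0∞) ∂μ ≠ ⊤ := by
    refine ne_top_of_le_ne_top ?_
      (lintegral_count_prod_univ_le_of_isTangentState hσ hφ hφ0 hφ1 hφi hfam hμ measurableSet_unitCube)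
    rw [volume_unitCube_three, mul_one]
    exact ENNReal.ofReal_ne_top
  -- any admissible cutoff data for the window bookkeeping lemma (only its integrability conjunct is used)
  have hδ₀ : (0 : ℝ) < 1 / 4 := by norm_num
  have hδ₀' : (1 / 4 : ℝ) ≤ 1 / 2 := by norm_num
  obtain ⟨ψ, hψc, -, hψ0, hψ1, hψsupp, hψinner, -, -⟩ := exists_position_cutoff hδ₀ hδ₀'
  obtain ⟨χ, hχc, -, hχ0, hχ1, hχR⟩ := exists_velocity_cutoff (0 : ℝ)
  obtain ⟨hSm, -⟩ := volume_real_shell_le hδ₀ hδ₀'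
  set S : Set V3 := unitCube (Fin 3) \ {y : V3 | ∀ i, y i ∈ Icc (1 / 4 : ℝ) (1 - 1 / 4)} with hSdef
  have hSc : S ⊆ unitCube (Fin 3) := fun _ hy => hy.1
  have hψS : ∀ y ∈ unitCube (Fin 3), y ∉ S → ψ y = 1 := fun y hy hyS =>
    hψinner y (by by_contra h; exact hyS ⟨hy, h⟩)
  exact (windowSum_approx μ hcube_fin hG hGK hψc hψ0 hψ1 hψsupp hSm hSc hψS hχc hχ0 hχ1 hχR).1

end Summit.AtomisticToContinuum.HydrodynamicLimit.Theorems.KiferCompactification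

end
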